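import Mathlib
import HarnessLib
import Summits.NavierStokesRegularity.NavierStokesRegularity.Theorems.PoloidalWindowDoorLrcModEntireRidgeWebRecurrentHull
import Summits.NavierStokesRegularity.NavierStokesRegularity.Theorems.PoloidalWindowDoorLrcModEntireRidgeWebClass

/-!
# Item `LrcModEntire` (stmt-NavierStokesRegularity-20428) / crux `PoloidalWindowRigidity` (19708) — THE RECURRENT UPGRADE OF THE (Q4) OBJECT:
# a hull element carrying the HOMOGENEOUS RIDGE WEB with the web laws which is UNIFORMLY RECURRENT under sliding along its own hot branch

Seat ns-poloidal-K2-p2 g15 (DIRECTOR-NS #301 (A)(1); LEAD K2-p3 g15 WANTED 11:58:41Z; `--supports stmt-NavierStokesRegularity-19708 --as helper`).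

* `exists_uniformlyRecurrent_ridgeWeb` — hypotheses = port-2's `…RidgeWebClass.exists_hullLimit_ridgeWeb` (p714382) WITHOUT the base sequence; conclusion =
  ITS conclusion (the pinned peakless hull element `U` with the same hot value, its limit branch `Γ` with the re-entry package, the signed component `F`, the
  homogeneous ridge height `R`, radius `r`, window `δ`, level `m`, (Q3∞), cold lateral / hot centre, strict concavity on the tube, THE WEB FERMAT LAW — verbatim,
  with the base sequence `sq` now existentially bound and no subsequence `φ`) PLUS UNIFORM RECURRENCE: for every `ε > 0` and slab index `n` the set of `σ'`
  with `U(·, · + Γ σ')` `ε`-close to `U` on `[−(n+2), −(n+2)⁻¹] × B̄_{n+2}` and `Γ(· + σ') − Γ σ'` `ε`-close to `Γ` on `[−(n+2), n+2]` is relatively dense.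

PROOF.  `…RidgeWebRecurrentHull.exists_uniformlyRecurrent_branchPair` gives a uniformly recurrent member `(U*, Γ*)` of the branch hull of `(v, γ)`.  Its
`(1/(m+1), slab m)`-returns give times `σ_m ≥ m + 1` along which the slid pairs CONVERGE BACK to `(U*, Γ*)`.  Apply port-2's `exists_hullLimit_ridgeWeb` to
`(U*, Γ*)` along `σ_m`: the hull element it returns has the SAME negative-time slices as `U*` and the SAME branch (limits are unique), so the (Q3∞)/cold–hot/
concavity/web-Fermat package it carries sits on a pair that is uniformly recurrent, and that pair is still in the branch hull of `(v, γ)` (same witnesses).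
(For the record: the return times move the base point `Γ*(σ_m)` to spatial infinity — LEAD's `…RidgeGlobalBranchProper.tendsto_norm_goodCurve_atTop` — but this
is not used.)

WHAT THIS IS NOT: not a claim about Navier–Stokes regularity — the (Q4) research cell now reads «value-homogeneous + UNIFORMLY RECURRENT null ridge in a strict
wave layer» and is OPEN; `stub_T2b`, item 20428, crux 19708, ⟨27893⟩ OPEN; no summit statement is proved here (bears_on LADDER-NS N0, rung N0-LocalTubeDoorPoloidal).
-/

noncomputable section

-- the summit and its single sub-problem share the name (CONVENTIONS §1), as in every Theorems file
set_option linter.dupNamespace false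

namespace Summit.NavierStokesRegularity.NavierStokesRegularity.Theorems.PoloidalWindowDoorLrcModEntireRidgeWebRecurrent

open Set Filter Topology Metric Function
open scoped ContDiff InnerProductSpace RealInnerProductSpace Laplacian
open Literature.Analysis Literature.Analysis.FluidPDE
open Summit.NavierStokesRegularity.NavierStokesRegularity.Theorems
open PoloidalWindowDoorLrcModEntireRidgeWebRecurrentHull PoloidalWindowDoorLrcModEntireRidgeWebClass

/-! ### Slabs exhaust the open half-space -/

/-- Every `(t, x)` with `t < 0` lies in all large slabs `[−(n+2), −(n+2)⁻¹] × B̄_{n+2}`. -/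
theorem eventually_mem_slab {t : ℝ} (ht : t < 0) (x : EuclideanSpace ℝ (Fin 3)) :
    ∀ᶠ n : ℕ in atTop, t ∈ Icc (-((n : ℝ) + 2)) (-((n : ℝ) + 2)⁻¹) ∧ x ∈ closedBall (0 : EuclideanSpace ℝ (Fin 3)) ((n : ℝ) + 2) := by
  obtain ⟨n₀, hn₀⟩ := exists_nat_ge (max (max ‖x‖ (-t)) (-t)⁻¹)
  filter_upwards [eventually_ge_atTop n₀] with n hn
  have hn' : (n₀ : ℝ) ≤ (n : ℝ) := Nat.cast_le.2 hn
  have hxr : ‖x‖ ≤ (n : ℝ) + 2 := by linarith [le_max_left (max ‖x‖ (-t)) (-t)⁻¹, le_max_left ‖x‖ (-t)]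
  have ht1 : -((n : ℝ) + 2) ≤ t := by linarith [le_max_left (max ‖x‖ (-t)) (-t)⁻¹, le_max_right ‖x‖ (-t)]
  have ht2 : t ≤ -((n : ℝ) + 2)⁻¹ := by
    have h1 : (-t)⁻¹ ≤ (n : ℝ) + 2 := by linarith [le_max_right (max ‖x‖ (-t)) (-t)⁻¹, norm_nonneg x, le_max_left (max ‖x‖ (-t)) (-t)⁻¹, le_max_left ‖x‖ (-t)]
    have h2 : ((n : ℝ) + 2)⁻¹ ≤ -t := inv_le_of_inv_le₀ (by linarith) h1
    linarith
  exact ⟨⟨ht1, ht2⟩, mem_closedBall.2 (by rwa [dist_zero_right])⟩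

/-- Every `s` lies in all large intervals `[−(n+2), n+2]`. -/
theorem eventually_mem_Icc (s : ℝ) : ∀ᶠ n : ℕ in atTop, s ∈ Icc (-((n : ℝ) + 2)) ((n : ℝ) + 2) := by
  obtain ⟨n₀, hn₀⟩ := exists_nat_ge |s|
  filter_upwards [eventually_ge_atTop n₀] with n hn
  have hn' : (n₀ : ℝ) ≤ (n : ℝ) := Nat.cast_le.2 hn
  exact ⟨by linarith [(abs_le.1 (hn₀.trans (by linarith : (n₀:ℝ) ≤ (n:ℝ) + 2))).1], (abs_le.1 (hn₀.trans (by linarith : (n₀:ℝ) ≤ (n:ℝ) + 2))).2⟩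

/-! ### The recurrent upgrade -/

/-- **THE RECURRENT UPGRADE OF THE (Q4) OBJECT.**  See the module docstring. -/
theorem exists_uniformlyRecurrent_ridgeWeb (C : ℝ) (v : ℝ → EuclideanSpace ℝ (Fin 3) → EuclideanSpace ℝ (Fin 3))
    (hP : (Literature.Analysis.FluidPDE.HasTypeITimeDecay C v ∧
        ContinuousOn (Function.uncurry v) (Set.Iio (0 : ℝ) ×ˢ Set.univ) ∧
        (∀ s t : ℝ, s < t → t < 0 → ∀ x, v t x =
          Literature.Analysis.UnboundedOperators.heatExtension (v s) (t - s) x -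
            Literature.Analysis.FluidPDE.oseenDuhamel 1 s v v t x) ∧
        (∀ t < 0, Literature.Analysis.FluidPDE.VectorCalculus.IsDivFree (v t)) ∧
        (∀ s < 0, ∀ q, ⟪Literature.Analysis.FluidPDE.curl (v s) q, EuclideanSpace.single 2 1⟫_ℝ = 0) ∧
        v (-1) 0 2 ≠ 0 ∧ (∀ t < 0, ∀ x, Real.sqrt (-t) * |v t x 2| ≤ |v (-1) 0 2|) ∧
        (∀ h : EuclideanSpace ℝ (Fin 3), fderiv ℝ (v (-1)) 0 h 2 = 0) ∧
        (deriv (fun s => v s 0 2) (-1) = v (-1) 0 2 / 2 ∧ v (-1) 0 2 * (Δ (fun q => v (-1) q 2)) 0 ≤ 0)))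
    (hK : (∀ (s z₀ σ M : ℝ) (K O : Set (EuclideanSpace ℝ (Fin 3))), s < 0 →
        ((σ = 1 ∨ σ = -1) ∧ IsCompact K ∧ K.Nonempty ∧ (∀ q ∈ K, q 2 = z₀ ∧ σ * v s q 2 = M) ∧
          IsOpen O ∧ K ⊆ O ∧ (∀ q ∈ O, q 2 = z₀ → σ * v s q 2 ≤ M) ∧
          (∀ q ∈ O, q 2 = z₀ → σ * v s q 2 = M → q ∈ K)) → False))
    {σ : ℝ} (hσ : σ = 1 ∨ σ = -1)
    {γ : ℝ → EuclideanSpace ℝ (Fin 3)} (hγ2 : ContDiff ℝ 2 γ) (hplane : ∀ s, γ s 2 = 0) (hunit : ∀ s, ‖deriv γ s‖ = 1)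
    (hhot : ∀ s, v (-1) (γ s) 2 = v (-1) 0 2)
    {ν : ℝ → EuclideanSpace ℝ (Fin 3)} (hν : ∀ s, ν s = WithLp.toLp 2 ![-(deriv γ s 1), deriv γ s 0, 0])
    {κ₀ : ℝ} (hκ₀ : 0 < κ₀) (hκ : ∀ s, κ₀ ≤ -(fderiv ℝ (fderiv ℝ (fun y => σ * v (-1) y 2)) (γ s) (ν s) (ν s))) :
    ∃ (sq : ℕ → ℝ) (U : ℝ → EuclideanSpace ℝ (Fin 3) → EuclideanSpace ℝ (Fin 3)) (Γ νΓ : ℝ → EuclideanSpace ℝ (Fin 3))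
      (F : ℝ → EuclideanSpace ℝ (Fin 3) → ℝ) (R : ℝ → ℝ → ℝ) (r δ m : ℝ),
      -- a branch-hull member of `(v, γ)` (pinned, peakless, same hot value) with its base sequence `sq`, and its branch `Γ`
      (Literature.Analysis.FluidPDE.HasTypeITimeDecay C U ∧
        ContinuousOn (Function.uncurry U) (Set.Iio (0 : ℝ) ×ˢ Set.univ) ∧
        (∀ s t : ℝ, s < t → t < 0 → ∀ x, U t x =
          Literature.Analysis.UnboundedOperators.heatExtension (U s) (t - s) x -
            Literature.Analysis.FluidPDE.oseenDuhamel 1 s U U t x) ∧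
        (∀ t < 0, Literature.Analysis.FluidPDE.VectorCalculus.IsDivFree (U t)) ∧
        (∀ s < 0, ∀ q, ⟪Literature.Analysis.FluidPDE.curl (U s) q, EuclideanSpace.single 2 1⟫_ℝ = 0) ∧
        U (-1) 0 2 ≠ 0 ∧ (∀ t < 0, ∀ x, Real.sqrt (-t) * |U t x 2| ≤ |U (-1) 0 2|) ∧
        (∀ h : EuclideanSpace ℝ (Fin 3), fderiv ℝ (U (-1)) 0 h 2 = 0) ∧
        (deriv (fun s => U s 0 2) (-1) = U (-1) 0 2 / 2 ∧ U (-1) 0 2 * (Δ (fun q => U (-1) q 2)) 0 ≤ 0)) ∧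
      (∀ (s z₀ σ M : ℝ) (K O : Set (EuclideanSpace ℝ (Fin 3))), s < 0 →
        ((σ = 1 ∨ σ = -1) ∧ IsCompact K ∧ K.Nonempty ∧ (∀ q ∈ K, q 2 = z₀ ∧ σ * U s q 2 = M) ∧
          IsOpen O ∧ K ⊆ O ∧ (∀ q ∈ O, q 2 = z₀ → σ * U s q 2 ≤ M) ∧
          (∀ q ∈ O, q 2 = z₀ → σ * U s q 2 = M → q ∈ K)) → False) ∧
      U (-1) 0 2 = v (-1) 0 2 ∧
      (∀ t < 0, TendstoLocallyUniformly (fun j x => v t (x + γ (sq j))) (U t) atTop) ∧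
      (∀ s, Tendsto (fun j => γ (sq j + s) - γ (sq j)) atTop (𝓝 (Γ s))) ∧
      -- re-entry package of the limit branch
      (∀ y ∈ {y : EuclideanSpace ℝ (Fin 3) | y 2 = 0 ∧ U (-1) y 2 = U (-1) 0 2}, fderiv ℝ (fun x => U (-1) x 2) y = 0) ∧
      ContDiff ℝ ∞ Γ ∧ Γ 0 = 0 ∧ (∀ s, Γ s 2 = 0) ∧ (∀ s, ‖deriv Γ s‖ = 1) ∧ (∀ s, U (-1) (Γ s) 2 = U (-1) 0 2) ∧
      (∀ s, νΓ s = WithLp.toLp 2 ![-(deriv Γ s 1), deriv Γ s 0, 0]) ∧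
      (∀ s, κ₀ ≤ -(fderiv ℝ (fderiv ℝ (fun y => σ * U (-1) y 2)) (Γ s) (νΓ s) (νΓ s))) ∧
      -- the signed space–time component, the homogeneous ridge height, the tube radius, the window, the level
      (F = fun τ y => σ * U (-1 + τ) y 2) ∧
      (∀ τ z, R τ z = sSup ((fun n : ℝ => F τ (Γ 0 + n • νΓ 0 + z • EuclideanSpace.single 2 (1 : ℝ))) '' Icc (-r) r)) ∧
      0 < r ∧ 0 < δ ∧ δ ≤ 1 / 4 ∧
      -- (Q3∞): the cross-section maximum is homogeneous along `Γ`
      (∀ τ z : ℝ, |τ| < δ → |z| < δ → ∀ s : ℝ,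
        sSup ((fun n : ℝ => F τ (Γ s + n • νΓ s + z • EuclideanSpace.single 2 (1 : ℝ))) '' Icc (-r) r) = R τ z) ∧
      -- cold lateral values, hot centre
      (∀ τ z : ℝ, |τ| < δ → |z| < δ → ∀ s n : ℝ, (n = r ∨ n = -r) → F τ (Γ s + n • νΓ s + z • EuclideanSpace.single 2 (1 : ℝ)) < m) ∧
      (∀ τ z : ℝ, |τ| < δ → |z| < δ → ∀ s : ℝ, m ≤ F τ (Γ s + z • EuclideanSpace.single 2 (1 : ℝ))) ∧
      -- strict concavity of the cross-sections on the open tube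
      (∀ τ z : ℝ, |τ| < δ → |z| < δ → ∀ s : ℝ, ∀ n ∈ Ioo (-r) r,
        fderiv ℝ (fderiv ℝ (F τ)) (Γ s + n • νΓ s + z • EuclideanSpace.single 2 (1 : ℝ)) (νΓ s) (νΓ s) < 0) ∧
      -- THE WEB FERMAT LAW at every cross-section
      (∀ τ₀ z₀ : ℝ, |τ₀| < δ → |z₀| < δ → ∀ s₀ : ℝ, ∃ n₀ ∈ Ioo (-r) r,
        F τ₀ (Γ s₀ + n₀ • νΓ s₀ + z₀ • EuclideanSpace.single 2 (1 : ℝ)) = R τ₀ z₀ ∧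
        (∀ n ∈ Icc (-r) r, n ≠ n₀ → F τ₀ (Γ s₀ + n • νΓ s₀ + z₀ • EuclideanSpace.single 2 (1 : ℝ)) < R τ₀ z₀) ∧
        DifferentiableAt ℝ (uncurry R) (τ₀, z₀) ∧
        fderiv ℝ (uncurry F) (τ₀, Γ s₀ + n₀ • νΓ s₀ + z₀ • EuclideanSpace.single 2 (1 : ℝ)) =
          (fderiv ℝ (uncurry R) (τ₀, z₀)).comp
            ((ContinuousLinearMap.fst ℝ ℝ (EuclideanSpace ℝ (Fin 3))).prod
              ((EuclideanSpace.proj (2 : Fin 3)).comp (ContinuousLinearMap.snd ℝ ℝ (EuclideanSpace ℝ (Fin 3)))))) ∧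
      -- UNIFORM RECURRENCE under sliding along the own branch
      (∀ ε : ℝ, 0 < ε → ∀ n : ℕ, ∃ L : ℝ, 0 < L ∧ ∀ a : ℝ, ∃ σ' ∈ Icc a (a + L),
        (∀ t ∈ Icc (-((n : ℝ) + 2)) (-((n : ℝ) + 2)⁻¹), ∀ x ∈ closedBall (0 : EuclideanSpace ℝ (Fin 3)) ((n : ℝ) + 2),
          dist (U t (x + Γ σ')) (U t x) < ε) ∧
        (∀ s ∈ Icc (-((n : ℝ) + 2)) ((n : ℝ) + 2), dist (Γ (s + σ') - Γ σ') (Γ s) < ε)) := by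

  have hP' := hP
  obtain ⟨-, -, -, -, -, hN, -, -, -⟩ := hP'
  -- ## a uniformly recurrent member of the branch hull
  obtain ⟨sq, Us, Γs, hPKs, hPLs, hNs, hsls, hbrs, ⟨hcrits, hΓss, hΓ0s, hΓpls, hΓuns, hΓhots, hκs⟩, hrecs⟩ :=
    exists_uniformlyRecurrent_branchPair C v hP hK hσ hγ2 hplane hunit hhot hν hκ₀ hκ
  -- ## its return times `σ m ≥ m + 1`
  have hret : ∀ m : ℕ, ∃ σ' : ℝ, (m : ℝ) + 1 ≤ σ' ∧
      (∀ t ∈ Icc (-((m : ℝ) + 2)) (-((m : ℝ) + 2)⁻¹), ∀ x ∈ closedBall (0 : EuclideanSpace ℝ (Fin 3)) ((m : ℝ) + 2),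
        dist (Us t (x + Γs σ')) (Us t x) < 1 / ((m : ℝ) + 1)) ∧
      (∀ s ∈ Icc (-((m : ℝ) + 2)) ((m : ℝ) + 2), dist (Γs (s + σ') - Γs σ') (Γs s) < 1 / ((m : ℝ) + 1)) := by
    intro m
    obtain ⟨L, hL, hwin⟩ := hrecs (1 / ((m : ℝ) + 1)) (by positivity) m
    obtain ⟨σ', hσ', h1, h2⟩ := hwin ((m : ℝ) + 1)
    exact ⟨σ', hσ'.1, h1, h2⟩
  choose σs hσs1 hσsU hσsΓ using hret
  have hσs : Tendsto σs atTop atTop := by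
    refine tendsto_atTop_mono hσs1 ?_
    exact tendsto_atTop_add_const_right _ 1 tendsto_natCast_atTop_atTop
  -- the slid pairs converge back along the return times (and along every subsequence)
  have hbackU : ∀ (φ : ℕ → ℕ), StrictMono φ → ∀ t < 0, ∀ x, Tendsto (fun j => Us t (x + Γs (σs (φ j)))) atTop (𝓝 (Us t x)) := by
    intro φ hφ t ht x
    rw [Metric.tendsto_nhds]
    intro ε hε
    obtain ⟨m₀, hm₀⟩ := exists_nat_gt (1 / ε)
    filter_upwards [(hφ.tendsto_atTop).eventually (eventually_mem_slab ht x), (hφ.tendsto_atTop).eventually (eventually_ge_atTop m₀)] with j hj hjm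
    have h := hσsU (φ j) t hj.1 x hj.2
    have hsmall : 1 / ((φ j : ℝ) + 1) < ε := by
      have hmj : (m₀ : ℝ) ≤ (φ j : ℝ) := Nat.cast_le.2 hjm
      rw [div_lt_iff₀ (by positivity)]
      rw [div_lt_iff₀ hε] at hm₀
      nlinarith
    exact h.trans hsmall
  have hbackΓ : ∀ (φ : ℕ → ℕ), StrictMono φ → ∀ s, Tendsto (fun j => Γs (σs (φ j) + s) - Γs (σs (φ j))) atTop (𝓝 (Γs s)) := by
    intro φ hφ s
    rw [Metric.tendsto_nhds]
    intro ε hε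
    obtain ⟨m₀, hm₀⟩ := exists_nat_gt (1 / ε)
    filter_upwards [(hφ.tendsto_atTop).eventually (eventually_mem_Icc s), (hφ.tendsto_atTop).eventually (eventually_ge_atTop m₀)] with j hj hjm
    have h := hσsΓ (φ j) s hj
    have hsmall : 1 / ((φ j : ℝ) + 1) < ε := by
      have hmj : (m₀ : ℝ) ≤ (φ j : ℝ) := Nat.cast_le.2 hjm
      rw [div_lt_iff₀ (by positivity)]
      rw [div_lt_iff₀ hε] at hm₀
      nlinarith
    rw [add_comm (σs (φ j)) s]
    exact h.trans hsmall
  -- ## port-2's (Q4) entrance along the return times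
  have hΓ2s : ContDiff ℝ 2 Γs := hΓss.of_le (by exact WithTop.coe_le_coe.2 le_top)
  set νs : ℝ → EuclideanSpace ℝ (Fin 3) := fun s => WithLp.toLp 2 ![-(deriv Γs s 1), deriv Γs s 0, 0] with hνsdef
  have hνs : ∀ s, νs s = WithLp.toLp 2 ![-(deriv Γs s 1), deriv Γs s 0, 0] := fun _ => rfl
  obtain ⟨φ, U, Γ, νΓ, F, R, r, δ, m, hφ, hPKU, hPLU, hUN, hconv, hptΓ, hcritU, hΓsm, hΓ0, hΓplane, hΓunit, hΓhot, hνΓ, hκU, hF, hR, hr, hδ, hδ14,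
    hhom, hlat, hmid, hconc, hweb⟩ :=
    exists_hullLimit_ridgeWeb C Us hPKs hPLs hσ hΓ2s hΓpls hΓuns hΓhots hνs hκ₀ hκs hσs
  -- ## identification: same negative-time slices, same branch
  have hUc : ∀ t < 0, Continuous (U t) := fun t ht =>
    PoloidalWindowDoorPoloidalWindowRigidityHotHullCompactness.continuous_slice_of_class hPKU.1 hPKU.2.1 hPKU.2.2.1 hPKU.2.2.2.1 ht
  have hUeq : ∀ t < 0, U t = Us t := by
    intro t ht
    funext x
    have h1 : Tendsto (fun j => Us t (x + Γs (σs (φ j)))) atTop (𝓝 (U t x)) :=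
      (tendstoLocallyUniformlyOn_univ.2 (hconv t ht)).tendsto_at (mem_univ x)
    exact tendsto_nhds_unique h1 (hbackU φ hφ t ht x)
  have hΓeq : Γ = Γs := funext fun s => tendsto_nhds_unique (hptΓ s) (hbackΓ φ hφ s)
  -- ## assemble
  refine ⟨sq, U, Γ, νΓ, F, R, r, δ, m, hPKU, hPLU, hUN.trans hNs, fun t ht => ?_, fun s => ?_, hcritU, hΓsm, hΓ0, hΓplane, hΓunit, hΓhot, hνΓ, hκU,
    hF, hR, hr, hδ, hδ14, hhom, hlat, hmid, hconc, hweb, fun ε hε n => ?_⟩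
  · rw [hUeq t ht]; exact hsls t ht
  · rw [hΓeq]; exact (tendstoLocallyUniformlyOn_univ.2 hbrs).tendsto_at (mem_univ s)
  · obtain ⟨L, hL, hwin⟩ := hrecs ε hε n
    refine ⟨L, hL, fun a => ?_⟩
    obtain ⟨σ', hσ', h1, h2⟩ := hwin a
    refine ⟨σ', hσ', fun t ht x hx => ?_, fun s hs => ?_⟩
    · have ht0 : t < 0 := by
        have h2' : (0 : ℝ) < ((n : ℝ) + 2)⁻¹ := by positivity
        linarith [ht.2]
      rw [hUeq t ht0, hΓeq]
      exact h1 t ht x hx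
    · rw [hΓeq]; exact h2 s hs

end Summit.NavierStokesRegularity.NavierStokesRegularity.Theorems.PoloidalWindowDoorLrcModEntireRidgeWebRecurrent

end
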